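import Mathlib
import Summits.PneNP.PneNP.Theorems.SymmetryBudgetHamCompilesRankKey

/-!
# Window bookkeeping for stub `stub_cutspan` of line `kotzig-cutspan` (crux
`SymmetryBudget.HamCompiles`, item stmt-PneNP-10637) — auxiliary file 3

Elementary facts about the window of the line (`SymmetryBudgetHamCompilesDefs.lean`, §2):

* `0 < g(m) < m` for `m ≥ 4`, `|freeSet m| ≤ g(m)`, `freeSet m ≠ ∅`;
* keys and ranks: `key` is injective (binary expansions, `Finset.geomSum_injective`), hence
  `rankOf` is injective on `classes`, ranks of free vertices are `< g(m)`, and ranks NAME classes: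
  there are tables `N : ℕ → Finset (Fin m)` with `N (rk u) = cls u` and
  `r : Finset (Fin m) → Fin (g m)` with `r (cls u) = rk u` for all free `u`;
* the two transports of junction-graph reachability between CLASS labels (`KotzigPred`) and RANK
  labels (`Residue₀`): `reachable_rank_of_reachable_cls`, `reachable_cls_of_reachable_rank`
  (graph homomorphisms induced by `r`, resp. `N`).
-/

-- `Summit.PneNP.PneNP.…` duplicates `PneNP` BY DESIGN (single-problem summit, D-0017).
set_option linter.dupNamespace false

noncomputable section

namespace Summit.PneNP.PneNP.Theorems.HamCompilesKC

open Finset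

namespace Cutspan

/-! ### The window -/

section Window

variable (m : ℕ) (x : Fin m × Fin m → Bool)

/-- `0 < g(m)` for `m ≥ 4`. -/
theorem gOf_pos {m : ℕ} (hm : 4 ≤ m) : 0 < gOf m :=
  Nat.log_pos (by norm_num) (by omega)

/-- `g(m) < m` for `m ≥ 4`. -/
theorem gOf_lt {m : ℕ} (hm : 4 ≤ m) : gOf m < m :=
  Nat.log_lt_self 2 (by omega)

/-- Membership in the free set. -/
theorem mem_freeSet {m : ℕ} (v : Fin m) : v ∈ freeSet m ↔ m ≤ (v : ℕ) + gOf m := by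
  simp [freeSet, IsAnch]

/-- The free set is nonempty for `m ≥ 4`. -/
theorem freeSet_nonempty {m : ℕ} (hm : 4 ≤ m) : (freeSet m).Nonempty := by
  refine ⟨⟨m - 1, by omega⟩, ?_⟩
  rw [mem_freeSet]
  have := gOf_pos hm
  simp only
  omega

/-- The free set has at most `g(m)` elements. -/
theorem card_freeSet_le (m : ℕ) : (freeSet m).card ≤ gOf m := by
  classical
  have hinj : Set.InjOn (fun v : Fin m => (v : ℕ) + gOf m - m) (freeSet m : Set (Fin m)) := by
    intro v hv w hw h
    simp only [Finset.mem_coe, mem_freeSet] at hv hw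
    apply Fin.ext
    simp only at h
    omega
  calc (freeSet m).card = ((freeSet m).image fun v : Fin m => (v : ℕ) + gOf m - m).card :=
        (Finset.card_image_of_injOn hinj).symm
    _ ≤ (Finset.range (gOf m)).card := by
        refine Finset.card_le_card fun k hk => ?_
        simp only [Finset.mem_image, mem_freeSet] at hk
        obtain ⟨v, hv, rfl⟩ := hk
        simp only [Finset.mem_range]
        have := v.2
        omega
    _ = gOf m := Finset.card_range _

/-- There are at most `g(m)` classes. -/
theorem card_classes_le : (classes m x).card ≤ gOf m :=
  Finset.card_image_le.trans (card_freeSet_le m)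

/-- The class of a free vertex is a class. -/
theorem cls_mem_classes {u : Fin m} (hu : u ∈ freeSet m) : cls m x u ∈ classes m x :=
  Finset.mem_image_of_mem _ hu

/-- `rankOf` is strictly monotone in `key` on the classes present. -/
theorem rankOf_lt_rankOf {N N' : Finset (Fin m)} (hN : N ∈ classes m x)
    (h : key m N < key m N') : rankOf m x N < rankOf m x N' := by
  unfold rankOf
  apply Finset.card_lt_card
  rw [Finset.ssubset_iff_of_subset]
  · refine ⟨N, ?_, ?_⟩
    · simp [hN, h]
    · simp
  · intro M hM
    simp only [Finset.mem_filter] at hM ⊢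
    exact ⟨hM.1, hM.2.trans h⟩

/-- Ranks name classes: `rankOf` is injective on the classes present. -/
theorem eq_of_rankOf_eq {N N' : Finset (Fin m)} (hN : N ∈ classes m x) (hN' : N' ∈ classes m x)
    (h : rankOf m x N = rankOf m x N') : N = N' := by
  rcases lt_trichotomy (key m N) (key m N') with hlt | heq | hgt
  · exact absurd h (rankOf_lt_rankOf m x hN hlt).ne
  · exact SymA.key_injective heq
  · exact absurd h (rankOf_lt_rankOf m x hN' hgt).ne'

/-- Free vertices of equal rank have equal classes. -/
theorem cls_eq_of_rk_eq {u v : Fin m} (hu : u ∈ freeSet m) (hv : v ∈ freeSet m)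
    (h : rk m x u = rk m x v) : cls m x u = cls m x v :=
  eq_of_rankOf_eq m x (cls_mem_classes m x hu) (cls_mem_classes m x hv) h

/-- The rank of a class present is `< g(m)`. -/
theorem rankOf_lt_of_mem {N : Finset (Fin m)} (hN : N ∈ classes m x) : rankOf m x N < gOf m := by
  unfold rankOf
  refine lt_of_lt_of_le ?_ (card_classes_le m x)
  apply Finset.card_lt_card
  rw [Finset.ssubset_iff_of_subset (Finset.filter_subset _ _)]
  exact ⟨N, hN, by simp⟩

/-- The rank of a free vertex is `< g(m)`. -/
theorem rk_lt {u : Fin m} (hu : u ∈ freeSet m) : rk m x u < gOf m :=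
  rankOf_lt_of_mem m x (cls_mem_classes m x hu)

/-- Ranks name classes: a table `N` with `N (rk u) = cls u` for every free `u`. -/
theorem exists_clsOfRank :
    ∃ N : ℕ → Finset (Fin m), ∀ u ∈ freeSet m, N (rk m x u) = cls m x u := by
  classical
  refine ⟨fun n => if h : ∃ u ∈ freeSet m, rk m x u = n then cls m x h.choose else ∅, ?_⟩
  intro u hu
  have h : ∃ v ∈ freeSet m, rk m x v = rk m x u := ⟨u, hu, rfl⟩
  dsimp only
  rw [dif_pos h]
  exact cls_eq_of_rk_eq m x h.choose_spec.1 hu h.choose_spec.2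

/-- Classes have ranks: a table `r` into `Fin (g m)` with `r (cls u) = rk u` for every free `u`
(`m ≥ 4`, so that `Fin (g m)` is nonempty). -/
theorem exists_rankFin {m : ℕ} (hm : 4 ≤ m) (x : Fin m × Fin m → Bool) :
    ∃ r : Finset (Fin m) → Fin (gOf m), ∀ u ∈ freeSet m, (r (cls m x u) : ℕ) = rk m x u := by
  refine ⟨fun N => if h : rankOf m x N < gOf m then ⟨rankOf m x N, h⟩ else ⟨0, gOf_pos hm⟩, ?_⟩
  intro u hu
  have h : rankOf m x (cls m x u) < gOf m := rk_lt m x hu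
  dsimp only
  rw [dif_pos h]
  rfl

end Window

/-! ### Transport of junction-graph reachability between class labels and rank labels -/

section Transport

/-- From CLASS labels to RANK labels: the rank table `r` (with `r (cls u) = rk u` on the free
set) is a graph homomorphism from the class-labelled junction graph of `(PF, PA)` to the
rank-labelled junction graph of `(PF, PA relabelled by r)`, provided all labels of `PA` are
classes of free vertices and all ends of `PF` are free. -/
theorem reachable_rank_of_reachable_cls {m : ℕ} (x : Fin m × Fin m → Bool)
    (r : Finset (Fin m) → Fin (gOf m))
    (hr : ∀ u ∈ freeSet m, (r (cls m x u) : ℕ) = rk m x u)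
    (PF : List (VSeq (Fin m))) (hends : ∀ p ∈ PF, p.first ∈ freeSet m ∧ p.last ∈ freeSet m)
    (PA : List (VSeq (Fin m) × (Finset (Fin m) × Finset (Fin m))))
    (hPA : ∀ q ∈ PA, (∃ u ∈ freeSet m, q.2.1 = cls m x u) ∧ (∃ u ∈ freeSet m, q.2.2 = cls m x u))
    {N N' : Finset (Fin m)} (h : (junctionGraph (cls m x) PF PA).Reachable N N') :
    (junctionGraph (fun v => r (cls m x v)) PF
      (PA.map fun q => (q.1, (r q.2.1, r q.2.2)))).Reachable (r N) (r N') := by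
  -- injectivity of `r` on classes of free vertices
  have hrinj : ∀ u ∈ freeSet m, ∀ v ∈ freeSet m, r (cls m x u) = r (cls m x v) →
      cls m x u = cls m x v := by
    intro u hu v hv huv
    apply cls_eq_of_rk_eq m x hu hv
    rw [← hr u hu, ← hr v hv, huv]
  let E : Finset (Fin m) → Finset (Fin m) → Prop := fun i j =>
    (∃ p ∈ PF, cls m x p.first = i ∧ cls m x p.last = j) ∨ (∃ q ∈ PA, q.2.1 = i ∧ q.2.2 = j)
  let PA' := PA.map fun q => (q.1, (r q.2.1, r q.2.2))
  let E' : Fin (gOf m) → Fin (gOf m) → Prop := fun i j =>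
    (∃ p ∈ PF, (fun v => r (cls m x v)) p.first = i ∧ (fun v => r (cls m x v)) p.last = j) ∨
      (∃ q ∈ PA', q.2.1 = i ∧ q.2.2 = j)
  have hEcls : ∀ a b, E a b →
      (∃ u ∈ freeSet m, a = cls m x u) ∧ (∃ u ∈ freeSet m, b = cls m x u) := by
    rintro a b (⟨p, hp, rfl, rfl⟩ | ⟨q, hq, rfl, rfl⟩)
    · exact ⟨⟨_, (hends p hp).1, rfl⟩, ⟨_, (hends p hp).2, rfl⟩⟩
    · exact hPA q hq
  have hEE' : ∀ a b, E a b → E' (r a) (r b) := by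
    rintro a b (⟨p, hp, rfl, rfl⟩ | ⟨q, hq, rfl, rfl⟩)
    · exact Or.inl ⟨p, hp, rfl, rfl⟩
    · exact Or.inr ⟨(q.1, (r q.2.1, r q.2.2)), List.mem_map.2 ⟨q, hq, rfl⟩, rfl, rfl⟩
  have hne : ∀ a b, E a b → a ≠ b → r a ≠ r b := by
    intro a b hab hne h
    obtain ⟨⟨u, hu, rfl⟩, ⟨v, hv, rfl⟩⟩ := hEcls a b hab
    exact hne (hrinj u hu v hv h)
  let f : junctionGraph (cls m x) PF PA →g junctionGraph (fun v => r (cls m x v)) PF PA' :=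
    { toFun := r
      map_rel' := by
        intro a b hab
        unfold junctionGraph at hab ⊢
        rw [SimpleGraph.fromRel_adj] at hab ⊢
        obtain ⟨hab, h | h⟩ := hab
        · exact ⟨hne a b h hab, Or.inl (hEE' a b h)⟩
        · exact ⟨(hne b a h (Ne.symm hab)).symm, Or.inr (hEE' b a h)⟩ }
  exact h.map f

/-- From RANK labels to CLASS labels: the class table `N` (with `N (rk u) = cls u` on the free
set) is a graph homomorphism from the rank-labelled junction graph of `(PF, PA)` (labels through
any `lab'` agreeing with `rk` on the free set) to the class-labelled junction graph of
`(PF, PA relabelled by N)`, provided all labels of `PA` are ranks of free vertices and all ends of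
`PF` are free. -/
theorem reachable_cls_of_reachable_rank {m : ℕ} (x : Fin m × Fin m → Bool)
    (lab' : Fin m → Fin (gOf m))
    (hlab' : ∀ u ∈ freeSet m, (lab' u : ℕ) = rk m x u)
    (N : ℕ → Finset (Fin m)) (hN : ∀ u ∈ freeSet m, N (rk m x u) = cls m x u)
    (PF : List (VSeq (Fin m))) (hends : ∀ p ∈ PF, p.first ∈ freeSet m ∧ p.last ∈ freeSet m)
    (PA : List (VSeq (Fin m) × (Fin (gOf m) × Fin (gOf m))))
    (hPA : ∀ q ∈ PA, (∃ u ∈ freeSet m, rk m x u = q.2.1) ∧ (∃ u ∈ freeSet m, rk m x u = q.2.2))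
    {i j : Fin (gOf m)} (h : (junctionGraph lab' PF PA).Reachable i j) :
    (junctionGraph (cls m x) PF
      (PA.map fun q => (q.1, (N q.2.1, N q.2.2)))).Reachable (N i) (N j) := by
  have hlabN : ∀ u ∈ freeSet m, N (lab' u) = cls m x u := by
    intro u hu; rw [hlab' u hu, hN u hu]
  let E : Fin (gOf m) → Fin (gOf m) → Prop := fun i j =>
    (∃ p ∈ PF, lab' p.first = i ∧ lab' p.last = j) ∨ (∃ q ∈ PA, q.2.1 = i ∧ q.2.2 = j)
  let PA' := PA.map fun q => (q.1, (N q.2.1, N q.2.2))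
  let E' : Finset (Fin m) → Finset (Fin m) → Prop := fun a b =>
    (∃ p ∈ PF, cls m x p.first = a ∧ cls m x p.last = b) ∨ (∃ q ∈ PA', q.2.1 = a ∧ q.2.2 = b)
  have hEE' : ∀ a b, E a b → E' (N a) (N b) := by
    rintro a b (⟨p, hp, rfl, rfl⟩ | ⟨q, hq, rfl, rfl⟩)
    · exact Or.inl ⟨p, hp, (hlabN _ (hends p hp).1).symm, (hlabN _ (hends p hp).2).symm⟩
    · exact Or.inr ⟨(q.1, (N q.2.1, N q.2.2)), List.mem_map.2 ⟨q, hq, rfl⟩, rfl, rfl⟩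
  have hne : ∀ a b, E a b → a ≠ b → N a ≠ N b := by
    rintro a b (⟨p, hp, rfl, rfl⟩ | ⟨q, hq, rfl, rfl⟩) hne h
    · rw [hlabN _ (hends p hp).1, hlabN _ (hends p hp).2] at h
      apply hne
      apply Fin.ext
      rw [hlab' _ (hends p hp).1, hlab' _ (hends p hp).2]
      change rankOf m x (cls m x p.first) = rankOf m x (cls m x p.last)
      rw [h]
    · obtain ⟨⟨u, hu, hu'⟩, ⟨v, hv, hv'⟩⟩ := hPA q hq
      rw [← hu', ← hv', hN u hu, hN v hv] at h
      apply hne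
      apply Fin.ext
      rw [← hu', ← hv']
      change rankOf m x (cls m x u) = rankOf m x (cls m x v)
      rw [h]
  let f : junctionGraph lab' PF PA →g junctionGraph (cls m x) PF PA' :=
    { toFun := fun a => N a
      map_rel' := by
        intro a b hab
        unfold junctionGraph at hab ⊢
        rw [SimpleGraph.fromRel_adj] at hab ⊢
        obtain ⟨hab, h | h⟩ := hab
        · exact ⟨hne a b h hab, Or.inl (hEE' a b h)⟩
        · exact ⟨(hne b a h (Ne.symm hab)).symm, Or.inr (hEE' b a h)⟩ }
  exact h.map f

end Transport

end Cutspan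

end Summit.PneNP.PneNP.Theorems.HamCompilesKC
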